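import Mathlib
import HarnessLib
import Literature.LinearAlgebra.Matrix.ChordalCholesky
import Literature.LinearAlgebra.Matrix.InverseMMatrix
import Literature.Combinatorics.SimpleGraph.EliminationGraph
import Summits.Ventures.LatticeQCDFlow.Scaling.AvoidingWalks

/-!
# LatticeQCDFlow / Scaling — NO CANCELLATION FOR STIELTJES MATRICES: the Cholesky (`L D Lᵀ`)
# factor of a positive-definite Z-matrix has EXACTLY the fill pattern, with negative entries

HONEST FRAMING: exact (Metropolis-corrected) sampling algorithms for lattice gauge theory;
figures of merit are autocorrelation/cost numbers at stated couplings and volumes; no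
continuum-physics claim.

Venture `LatticeQCDFlow` (cell pub-lqcd), topic `Scaling`, FANOUT row 30 (lean-1) — OUR WORK, file 5
of the AUTOREGRESSIVE-CONTEXT (ELIMINATION-FRONT) VOLUME LAW.  A STIELTJES matrix is a real
symmetric positive-definite matrix with non-positive off-diagonal entries
(`Literature.LinearAlgebra.Matrix.IsZMatrix`; the precision matrix of a "ferromagnetic" Gaussian
field, e.g. the massive lattice free field `-Δ + m²`).  Its GRAPH joins `i ≠ j` when `X i j ≠ 0`
(`matrixGraph`).  The tree's `ChordalCholesky.lean` ([VandenbergheAndersen2015, §9.1]) gives the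
unique factorisation `X = L D Lᵀ` (`L` unit lower triangular for the order of the index type,
`D = diag d ≻ 0`) and the INCLUSION of the pattern of `L` in the filled graph; here we prove that
for Stieltjes matrices the inclusion is an EQUALITY and the signs are determined:

* `matrixGraph X`; the walk calculus `AvoidWalk` is `Scaling/AvoidingWalks.lean`.
* **`exists_signed_outerProduct`** — the outer-product Cholesky recursion along the order, run on a
  positive-semidefinite Z-matrix, carrying the invariant "entry `(i,j)` of the current Schur
  complement is `< 0` iff `i`, `j` are joined by a walk through ELIMINATED vertices": one step
  `Y = X - X_{:,a} X_{a,:}/X_{aa}` has `Y_{ij} = X_{ij} - X_{ia}X_{aj}/X_{aa} ≤ X_{ij} ≤ 0`, and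
  `Y_{ij} < 0` iff `X_{ij} < 0` or (`X_{ia} < 0` and `X_{aj} < 0`) — two non-positive
  contributions never cancel.
* **`stieltjes_ldl`** — for a Stieltjes `X`: `X = L·diag(d)·Lᵀ` with `L` unit lower triangular,
  `d > 0`, `L i a ≤ 0` off the diagonal, and for `a < i`: **`L i a < 0 ↔ {a, i}` is an edge of the
  elimination graph** of `matrixGraph X` (`Literature.Combinatorics.SimpleGraph.elimGraph`: a path
  from `a` to `i` with interior below `a`); `ldl_unique_real` — every unit-lower `L D Lᵀ`
  factorisation of `X` is this one (`ChordalCholesky.ldl_unique`).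
READING: the column `a` of `L` lists the coefficients with which the sites ABOVE `a` enter the
conditional mean of site `a` in the exact autoregressive (triangular) sampler of `N(0, X⁻¹)` that
generates the largest site first (sequel `Scaling/AutoregressiveContextLaw.lean`); its support is
exactly the higher fill-neighbourhood `adj⁺_*(a)`, of size `≥ c_d L^{d-1}` for some `a` on the torus
(`Scaling/EliminationFrontTorus.lean`).  Elementary; nothing is cited as a fact; `def
matrixGraph`; no `sorry`.
-/

noncomputable section

namespace Summit.Ventures.LatticeQCDFlow.Theory2.Autoregressive

open Matrix Finset
open Literature.LinearAlgebra.Matrix (IsZMatrix)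
open Literature.LinearAlgebra.Matrix.ChordalSparsity
open Literature.Combinatorics.SimpleGraph

variable {ι : Type*}

/-! ## 1. The graph of a matrix; the signed outer-product recursion -/

section Recursion

variable [Fintype ι] [LinearOrder ι]

/-- The GRAPH of a square matrix: `i ≠ j` adjacent iff `X i j ≠ 0` or `X j i ≠ 0`. [folklore] -/
def matrixGraph (X : Matrix ι ι ℝ) : SimpleGraph ι where
  Adj i j := i ≠ j ∧ (X i j ≠ 0 ∨ X j i ≠ 0)
  symm := ⟨fun _ _ h => ⟨h.1.symm, h.2.symm⟩⟩
  loopless := ⟨fun _ h => h.1 rfl⟩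

omit [Fintype ι] [LinearOrder ι] in
/-- For a symmetric Z-matrix, adjacency in the graph is `X i j < 0`. [folklore] -/
theorem matrixGraph_adj_iff {X : Matrix ι ι ℝ} (hXh : X.IsHermitian) (hZ : IsZMatrix X) {i j : ι}
    (hij : i ≠ j) : (matrixGraph X).Adj i j ↔ X i j < 0 := by
  have hsymm : X j i = X i j := by
    simpa using hXh.apply i j
  change (i ≠ j ∧ (X i j ≠ 0 ∨ X j i ≠ 0)) ↔ _
  rw [hsymm, or_self]
  exact ⟨fun h => lt_of_le_of_ne (hZ i j hij) h.2, fun h => ⟨hij, h.ne⟩⟩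

/-- **THE SIGNED OUTER-PRODUCT (CHOLESKY) RECURSION FOR Z-MATRICES.**  Let `X ⪰ 0` be a real
Z-matrix supported on `S × S` whose negative entries are exactly the pairs of `S` joined in `G` by
a walk avoiding `S` (at the start, `S = univ`: the edges of `G`).  Eliminating the vertices of `S`
in increasing order writes `X = Σ_a d_a ℓ_a ℓ_aᵀ` with `d ≥ 0` (`= 0` off `S`), `ℓ_a(a) = 1`,
`ℓ_a ≤ 0` off `a`, `ℓ_a` supported on `{a} ∪ {i ∈ S | a < i}`, and — NO CANCELLATION — for
`a < i` in `S`: `ℓ_a(i) < 0` iff `i` and `a` are joined by a walk of `G` avoiding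
`{b ∈ S | a ≤ b}` (a walk through vertices eliminated before `a`). [folklore] -/
theorem exists_signed_outerProduct (G : SimpleGraph ι) (S : Finset ι) :
    ∀ X : Matrix ι ι ℝ, X.PosSemidef → IsZMatrix X → SupportedOn (↑S : Set ι) X →
      (∀ i ∈ S, ∀ j ∈ S, i ≠ j → (X i j < 0 ↔ AvoidWalk G ↑S i j)) →
      ∃ (ℓ : ι → ι → ℝ) (d : ι → ℝ), (∀ a, ℓ a a = 1) ∧ (∀ a i, i ≠ a → ℓ a i ≤ 0) ∧
        (∀ a i, ℓ a i ≠ 0 → i = a ∨ (a ∈ S ∧ i ∈ S ∧ a < i)) ∧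
        (∀ a ∈ S, ∀ i ∈ S, a < i →
          (ℓ a i < 0 ↔ AvoidWalk G ↑(S.filter fun b => a ≤ b) i a)) ∧
        (∀ a, 0 ≤ d a) ∧ (∀ a, a ∉ S → d a = 0) ∧ X = ∑ a, d a • vecMulVec (ℓ a) (ℓ a) := by
  classical
  induction S using Finset.induction_on_min with
  | empty =>
    intro X hX hZ hXS hconn
    refine ⟨fun a => Pi.single a 1, fun _ => 0, fun a => Pi.single_eq_same a 1, ?_, ?_, ?_,
      fun _ => le_rfl, fun _ _ => rfl, ?_⟩
    · intro a i hia; simp [Pi.single_eq_of_ne hia]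
    · intro a i h
      by_cases hia : i = a
      · exact Or.inl hia
      · exfalso; apply h; simp [hia]
    · simp
    · ext i j
      rw [hXS (Or.inl (by simp))]
      simp
  | insert a s hlt ih =>
    intro X hX hZ hXS hconn
    have hXh : X.IsHermitian := hX.1
    have hsymm : ∀ i j, X j i = X i j := fun i j => by simpa using hXh.apply i j
    have has : a ∉ s := fun h => lt_irrefl a (hlt a h)
    -- the invariant passes to `s` through the splitting lemma
    have hsplit : ∀ i ∈ s, ∀ j ∈ s, i ≠ j →
        (AvoidWalk G ↑s i j ↔ AvoidWalk G ↑(insert a s) i j ∨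
          (AvoidWalk G ↑(insert a s) i a ∧ AvoidWalk G ↑(insert a s) a j)) := fun i _ j hj _ => by
      rw [Finset.coe_insert a s]
      exact avoidWalk_iff_of_insert (by exact_mod_cast has) (fun h => has (h ▸ hj))
    -- the filters `{b ∈ insert a s | c ≤ b}` for `c = a` and for `c ∈ s`
    have hfilter_a : (insert a s).filter (fun b => a ≤ b) = insert a s := by
      refine Finset.filter_true_of_mem fun b hb => ?_
      rcases Finset.mem_insert.mp hb with rfl | hb
      exacts [le_rfl, (hlt b hb).le]
    have hfilter_s : ∀ c ∈ s, (insert a s).filter (fun b => c ≤ b) = s.filter (fun b => c ≤ b) := by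
      intro c hc
      rw [Finset.filter_insert, if_neg (not_le.mpr (hlt c hc))]
    by_cases ha : X a a = 0
    · -- ZERO PIVOT: row and column `a` vanish, `X` lives on `s`, no vertex is joined to `a`
      have hcol0 : ∀ i, X i a = 0 := fun i => (apply_eq_zero_of_diag_eq_zero hX ha i).1
      have hXs : SupportedOn (↑s : Set ι) X := by
        intro i j hij
        rcases hij with hi | hj
        · by_cases hia : i = a
          · rw [hia]; exact (apply_eq_zero_of_diag_eq_zero hX ha j).2
          · exact hXS (Or.inl (by simp [hia, hi]))
        · by_cases hja : j = a
          · rw [hja]; exact (apply_eq_zero_of_diag_eq_zero hX ha i).1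
          · exact hXS (Or.inr (by simp [hja, hj]))
      have hnoa : ∀ i ∈ s, ¬ AvoidWalk G ↑(insert a s) i a := by
        intro i hi hw
        have hia : i ≠ a := fun h => has (h ▸ hi)
        have := (hconn i (by simp [hi]) a (by simp) hia).mpr hw
        rw [hcol0 i] at this
        exact lt_irrefl 0 this
      have hconn' : ∀ i ∈ s, ∀ j ∈ s, i ≠ j → (X i j < 0 ↔ AvoidWalk G ↑s i j) := by
        intro i hi j hj hij
        rw [hsplit i hi j hj hij, hconn i (by simp [hi]) j (by simp [hj]) hij]
        constructor
        · exact Or.inl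
        · rintro (h | ⟨h, -⟩)
          · exact h
          · exact absurd h (hnoa i hi)
      obtain ⟨ℓ, d, h1, h2, h3, h4, h5, h7, h6⟩ := ih X hX hZ hXs hconn'
      refine ⟨ℓ, d, h1, h2, fun c i h => ?_, fun c hc i hi hci => ?_, h5,
        fun c hc => h7 c fun h => hc (Finset.mem_insert_of_mem h), h6⟩
      · rcases h3 c i h with h | ⟨hc, hi, hci⟩
        exacts [Or.inl h, Or.inr ⟨by simp [hc], by simp [hi], hci⟩]
      · rcases Finset.mem_insert.mp hc with rfl | hc
        · -- column of the zero pivot: `ℓ c i = 0`, and nothing is joined to `c`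
          rw [hfilter_a]
          have hi' : i ∈ s := (Finset.mem_insert.mp hi).resolve_left (ne_of_gt hci)
          have h0 : ℓ c i = 0 := by
            by_contra h
            rcases h3 c i h with h | ⟨hc', -, -⟩
            · exact (ne_of_gt hci) h
            · exact has hc'
          rw [h0]
          exact ⟨fun h => absurd h (lt_irrefl 0), fun h => absurd h (hnoa i hi')⟩
        · have hi' : i ∈ s :=
            (Finset.mem_insert.mp hi).resolve_left (ne_of_gt ((hlt c hc).trans hci))
          rw [hfilter_s c hc]
          exact h4 c hc i hi' hci
    · -- NONZERO PIVOT `X a a > 0`: split off `X_{aa} • v vᵀ = pivotTerm X a`, `v = X_{:,a}/X_{aa}`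
      have hpos : 0 < X a a := lt_of_le_of_ne (hX.diag_nonneg (i := a)) (Ne.symm ha)
      set Y : Matrix ι ι ℝ := X - pivotTerm X a with hYdef
      have hYapply : ∀ i j, Y i j = X i j - (X a a)⁻¹ * (X i a * X a j) := fun i j => by
        rw [hYdef, Matrix.sub_apply, pivotTerm_apply]
      have hY : Y.PosSemidef := posSemidef_sub_pivotTerm hX ha
      have hYS : SupportedOn (↑s : Set ι) Y := by
        intro i j hij
        rcases hij with hi | hj
        · by_cases hia : i = a
          · rw [hia]; exact sub_pivotTerm_apply_row X ha j
          · have hi' : i ∉ (↑(insert a s) : Set ι) := by simp [hia, hi]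
            rw [hYapply, hXS (Or.inl hi'), show X i a = 0 from hXS (Or.inl hi')]
            ring
        · by_cases hja : j = a
          · rw [hja]; exact sub_pivotTerm_apply_col X ha i
          · have hj' : j ∉ (↑(insert a s) : Set ι) := by simp [hja, hj]
            rw [hYapply, hXS (Or.inr hj'), show X a j = 0 from hXS (Or.inr hj')]
            ring
      have hprod : ∀ i j, i ≠ a → j ≠ a → 0 ≤ (X a a)⁻¹ * (X i a * X a j) := fun i j hia hja =>
        mul_nonneg (inv_nonneg.mpr hpos.le) (mul_nonneg_of_nonpos_of_nonpos (hZ i a hia)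
          (hZ a j (Ne.symm hja)))
      have hYZ : IsZMatrix Y := by
        intro i j hij
        by_cases hia : i = a
        · rw [hia, hYdef, sub_pivotTerm_apply_row X ha j]
        by_cases hja : j = a
        · rw [hja, hYdef, sub_pivotTerm_apply_col X ha i]
        rw [hYapply]
        linarith [hZ i j hij, hprod i j hia hja]
      -- NO CANCELLATION: `Y i j < 0 ↔ X i j < 0 ∨ (X i a < 0 ∧ X a j < 0)`
      have hYneg : ∀ i j, i ≠ a → j ≠ a → i ≠ j →
          (Y i j < 0 ↔ X i j < 0 ∨ (X i a < 0 ∧ X a j < 0)) := by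
        intro i j hia hja hij
        rw [hYapply]
        have hij0 := hZ i j hij
        have hia0 := hZ i a hia
        have haj0 := hZ a j (Ne.symm hja)
        have hp := hprod i j hia hja
        constructor
        · intro h
          by_cases hx : X i j < 0
          · exact Or.inl hx
          · right
            have hx0 : X i j = 0 := le_antisymm hij0 (not_lt.mp hx)
            have hne : X i a * X a j ≠ 0 := by
              intro h0; rw [hx0, h0] at h; simp at h
            rcases mul_ne_zero_iff.mp hne with ⟨h₁, h₂⟩
            exact ⟨lt_of_le_of_ne hia0 h₁, lt_of_le_of_ne haj0 h₂⟩
        · rintro (h | ⟨h₁, h₂⟩)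
          · linarith
          · have : 0 < (X a a)⁻¹ * (X i a * X a j) :=
              mul_pos (inv_pos.mpr hpos) (mul_pos_of_neg_of_neg h₁ h₂)
            linarith
      have hconn' : ∀ i ∈ s, ∀ j ∈ s, i ≠ j → (Y i j < 0 ↔ AvoidWalk G ↑s i j) := by
        intro i hi j hj hij
        have hia : i ≠ a := fun h => has (h ▸ hi)
        have hja : j ≠ a := fun h => has (h ▸ hj)
        rw [hYneg i j hia hja hij, hsplit i hi j hj hij,
          hconn i (by simp [hi]) j (by simp [hj]) hij, hconn i (by simp [hi]) a (by simp) hia,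
          hconn a (by simp) j (by simp [hj]) (Ne.symm hja)]
      obtain ⟨ℓ, d, h1, h2, h3, h4, h5, h7, h6⟩ := ih Y hY hYZ hYS hconn'
      set v : ι → ℝ := fun i => (X a a)⁻¹ * X i a with hvdef
      have hK : pivotTerm X a = X a a • vecMulVec v v := by
        ext i j
        simp only [pivotTerm_apply, Matrix.smul_apply, vecMulVec_apply, smul_eq_mul, hvdef]
        rw [hsymm a j]
        field_simp
      refine ⟨fun c => if c = a then v else ℓ c, fun c => if c = a then X a a else d c,
        ?_, ?_, ?_, ?_, ?_, ?_, ?_⟩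
      · intro c
        by_cases hc : c = a
        · subst hc; simp [hvdef, inv_mul_cancel₀ ha]
        · simp [hc, h1 c]
      · intro c i hic
        by_cases hc : c = a
        · subst hc
          simp only [if_true, hvdef]
          exact mul_nonpos_of_nonneg_of_nonpos (inv_nonneg.mpr hpos.le) (hZ i c hic)
        · simp only [hc, if_false]; exact h2 c i hic
      · intro c i h
        by_cases hc : c = a
        · subst hc
          simp only [if_true, hvdef] at h
          by_cases hic : i = c
          · exact Or.inl hic
          · right
            have hX0 : X i c ≠ 0 := fun h0 => h (by rw [h0, mul_zero])
            have hiS : i ∈ insert c s := by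
              by_contra hi
              exact hX0 (hXS (Or.inl (by exact_mod_cast hi)))
            have his : i ∈ s := (Finset.mem_insert.mp hiS).resolve_left hic
            exact ⟨by simp, hiS, hlt i his⟩
        · simp only [hc, if_false] at h
          rcases h3 c i h with h' | ⟨hc', hi', hci⟩
          exacts [Or.inl h', Or.inr ⟨by simp [hc'], by simp [hi'], hci⟩]
      · intro c hc i hi hci
        by_cases hca : c = a
        · subst hca
          rw [hfilter_a]
          simp only [if_true, hvdef]
          have hic : i ≠ c := ne_of_gt hci
          rw [← hconn i hi c hc hic]
          constructor
          · intro h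
            exact lt_of_le_of_ne (hZ i c hic) fun h0 => by
              rw [h0, mul_zero] at h; exact lt_irrefl 0 h
          · intro h
            exact mul_neg_of_pos_of_neg (inv_pos.mpr hpos) h
        · have hc' : c ∈ s := (Finset.mem_insert.mp hc).resolve_left hca
          have hi' : i ∈ s :=
            (Finset.mem_insert.mp hi).resolve_left (ne_of_gt ((hlt c hc').trans hci))
          simp only [hca, if_false]
          rw [hfilter_s c hc']
          exact h4 c hc' i hi' hci
      · intro c
        by_cases hc : c = a
        · subst hc; simp [hpos.le]
        · simp [hc, h5 c]
      · intro c hc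
        have hca : c ≠ a := fun h => hc (by simp [h])
        have hcs : c ∉ s := fun h => hc (Finset.mem_insert_of_mem h)
        simp [hca, h7 c hcs]
      · -- `X = pivotTerm X a + Y`, `pivotTerm X a = X_{aa} • v vᵀ`, and `d a = 0` (`a ∉ s`)
        have hda : d a = 0 := h7 a has
        rw [← Finset.add_sum_erase Finset.univ _ (Finset.mem_univ a)]
        simp only [if_true]
        rw [Finset.sum_congr rfl fun c hc => by
          rw [if_neg (Finset.ne_of_mem_erase hc), if_neg (Finset.ne_of_mem_erase hc)]]
        rw [← hK]
        have hYsum : Y = ∑ c ∈ Finset.univ.erase a, d c • vecMulVec (ℓ c) (ℓ c) := by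
          rw [h6, ← Finset.add_sum_erase Finset.univ _ (Finset.mem_univ a), hda, zero_smul,
            zero_add]
        rw [← hYsum, hYdef, add_sub_cancel]

end Recursion

/-! ## 2. The Cholesky factor of a Stieltjes matrix: signs and exact fill -/

section Stieltjes

variable [Fintype ι] [LinearOrder ι] {G : SimpleGraph ι}

omit [Fintype ι] in
/-- For `a < i`: a walk from `i` to `a` avoiding `{b | a ≤ b}` is a lower path from `a` to `i` in
the sense of `EliminationGraph.lean`, i.e. the fill edge `{a, i}`. [folklore] -/
theorem avoidWalk_Ici_iff_elimGraph_adj {a i : ι} (hai : a < i) :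
    AvoidWalk G {b | a ≤ b} i a ↔ (elimGraph G).Adj a i := by
  rw [elimGraph_adj_iff]
  constructor
  · intro h
    obtain ⟨p, hp⟩ := h.symm
    refine ⟨hai.ne, p, fun z hz => ?_⟩
    rcases hp z hz with h | h | h
    exacts [Or.inl h, Or.inr (Or.inl h), Or.inr (Or.inr ⟨not_le.mp h, (not_le.mp h).trans hai⟩)]
  · rintro ⟨-, p, hp⟩
    refine AvoidWalk.symm ⟨p, fun z hz => ?_⟩
    rcases hp z hz with h | h | h
    exacts [Or.inl h, Or.inr (Or.inl h), Or.inr (Or.inr (not_le.mpr h.1))]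

/-- **THE CHOLESKY FACTOR OF A STIELTJES MATRIX: NON-POSITIVE, WITH EXACTLY THE FILL PATTERN.**
A real positive-definite Z-matrix `X` factors as `X = L·diag(d)·Lᵀ` with `L` unit lower
triangular (for the order of `ι`), `d > 0`, all off-diagonal entries of `L` non-positive, and for
`a < i`: `L i a < 0` iff `{a, i}` is an edge of the ELIMINATION GRAPH of the graph of `X` (a path
of nonzero entries from `a` to `i` through indices below `a`) — no accidental cancellation; in
particular `L i a ≠ 0` iff `{a,i}` is a fill edge. [folklore] -/
theorem stieltjes_ldl {X : Matrix ι ι ℝ} (hX : X.PosDef) (hZ : IsZMatrix X) :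
    ∃ (L : Matrix ι ι ℝ) (d : ι → ℝ), IsUnitLowerTriangular L ∧ (∀ a, 0 < d a) ∧
      X = L * diagonal d * Lᵀ ∧ (∀ i a, i ≠ a → L i a ≤ 0) ∧
      (∀ i a, a < i → (L i a < 0 ↔ (elimGraph (matrixGraph X)).Adj a i)) ∧
      (∀ i a, a < i → (L i a ≠ 0 ↔ (elimGraph (matrixGraph X)).Adj a i)) := by
  classical
  have hXh : X.IsHermitian := hX.1
  have hconn : ∀ i ∈ (univ : Finset ι), ∀ j ∈ (univ : Finset ι), i ≠ j →
      (X i j < 0 ↔ AvoidWalk (matrixGraph X) ↑(univ : Finset ι) i j) := by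
    intro i _ j _ hij
    rw [Finset.coe_univ, avoidWalk_univ_iff hij, matrixGraph_adj_iff hXh hZ hij]
  obtain ⟨ℓ, d, h1, h2, h3, h4, h5, -, h6⟩ := exists_signed_outerProduct (matrixGraph X) univ X
    hX.posSemidef hZ (fun i j hij => by simp at hij) hconn
  set L : Matrix ι ι ℝ := Matrix.of fun i a => ℓ a i with hLdef
  have hL : IsUnitLowerTriangular L := by
    refine ⟨fun i j hij => ?_, fun a => h1 a⟩
    have hij' : i < j := OrderDual.toDual_lt_toDual.mp hij
    by_contra h
    rcases h3 j i h with h' | ⟨-, -, hji⟩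
    · exact absurd h' hij'.ne
    · exact absurd hij' (not_lt.mpr hji.le)
  have hXeq : X = L * diagonal d * Lᵀ := by
    rw [h6]
    ext i j
    rw [Matrix.sum_apply, Matrix.mul_apply]
    refine Finset.sum_congr rfl fun a _ => ?_
    simp only [Matrix.mul_diagonal, Matrix.transpose_apply, hLdef, Matrix.of_apply,
      Matrix.smul_apply, vecMulVec_apply, smul_eq_mul]
    ring
  have hfill : ∀ i a, a < i → (L i a < 0 ↔ (elimGraph (matrixGraph X)).Adj a i) := by
    intro i a hai
    rw [← avoidWalk_Ici_iff_elimGraph_adj hai]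
    have hset : (↑(univ.filter fun b : ι => a ≤ b) : Set ι) = {b | a ≤ b} := by
      ext b; simp
    rw [← hset]
    exact h4 a (mem_univ a) i (mem_univ i) hai
  have hdpos : ∀ a, 0 < d a := by
    intro a
    refine diag_pos_of_ldl (𝕜 := ℝ) hX hL ?_ a
    rw [Matrix.conjTranspose_eq_transpose_of_trivial]
    exact hXeq
  refine ⟨L, d, hL, hdpos, hXeq, fun i a hia => h2 a i hia, hfill, fun i a hai => ?_⟩
  rw [← hfill i a hai]
  exact ⟨fun h => lt_of_le_of_ne (h2 a i (ne_of_gt hai)) h, fun h => h.ne⟩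

/-- **Uniqueness**: every factorisation `X = L' diag(d') L'ᵀ` of the Stieltjes matrix `X` with `L'`
unit lower triangular is the one of `stieltjes_ldl` — so THE Cholesky factor has the signs and the
exact fill pattern (`ChordalCholesky.ldl_unique`). [folklore] -/
theorem ldl_unique_real {X L₁ L₂ : Matrix ι ι ℝ} {d₁ d₂ : ι → ℝ} (hX : X.PosDef)
    (hL₁ : IsUnitLowerTriangular L₁) (hL₂ : IsUnitLowerTriangular L₂)
    (h₁ : X = L₁ * diagonal d₁ * L₁ᵀ) (h₂ : X = L₂ * diagonal d₂ * L₂ᵀ) :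
    L₁ = L₂ ∧ d₁ = d₂ := by
  refine ldl_unique (𝕜 := ℝ) hX hL₁ hL₂ ?_ ?_
  · rw [Matrix.conjTranspose_eq_transpose_of_trivial]; exact h₁
  · rw [Matrix.conjTranspose_eq_transpose_of_trivial]; exact h₂

end Stieltjes

end Summit.Ventures.LatticeQCDFlow.Theory2.Autoregressive
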